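import Summits.RiemannHypothesis.RiemannHypothesis.Theorems.GroundBartaEvenWinsBeyondArchDeflationWindowLoc2
import Summits.RiemannHypothesis.RiemannHypothesis.Theorems.GroundBartaEvenWinsBeyondArchDeflationWindowConst4
import Summits.RiemannHypothesis.RiemannHypothesis.Theorems.GroundBartaEvenWinsBeyondArchDeflationPanelQLoc1Four
import HarnessLib

/-!
# RiemannHypothesis / GroundBarta — rung 4 (`EvenWinsBeyondArch`, stmt-RiemannHypothesis-18807 / 18085):
# the deflated Temple L-side beyond `(log 5)/2`, XIX d′ (four slots) — the window bundle `dt_WinL4` from kernel checks, `s_i` from the `q_j`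

Helper file (`--supports stmt-RiemannHypothesis-18807`), RH-free, Mathlib + landed tree files only, no facts.  rh-explicit seat
weil-5 (lead ruling R3-8a, 2026-08-22), four-slot twin of the window-dependent end of prover B's …DeflationWindowLoc2 (file XIX d′):
* `dt_constCheckL4` / `dt_constCheckL4_sound` — B's one cheap check of the window constants plus the fourth slot
  (`dt_IwSqrt … 5 ∋ log 5/√5`, `MI.logNat … 5 ∋ log 5`) and the four-window range test `dt_fourWindowCheck` (prover A g12,
  …DeflationWindowConst4: `(log 5)/2 < c ≤ (log 7)/2`);
* `dt_mkWinL4` — the bundle `dt_WinL4` (slots `(log 2/√2, log 2)`, `(log 3/√3, log 3)`, `(log 2/2, log 4)`, `(log 5/√5, log 5)`)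
  from that check and the entry facts (ρ-panel models, moments, G-moments, edge data exactly as in `dt_mkWinL`);
  `dt_mkWinL4_window` — the certified range, i.e. the hypotheses of `dt_hprimes_four`;
* `dt_hs_of_panelQL4` — `∫‖F_i − Σ_l W_il v_l‖² ≤ 2 Σ_{j<m} q_j` from per-panel bounds of `dt_windowResidual4` (…WindowGlue4).
The slot-free makers (`dt_rho_entryL`, `dt_momsL`, `dt_gmoms0L`, `dt_tabEntryL`, …, file XIX d′ part 1) are B's, unchanged.

References: E. Bombieri, Rend. Mat. Acc. Lincei (9) 11 (2000) Thm 2 [Bombieri2000Weil]; Goerisch–Haunhorst (1985) [GoerischHaunhorst1985].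
-/

set_option linter.dupNamespace false

noncomputable section

open MeasureTheory Set Filter intervalIntegral
open scoped Topology BigOperators

namespace Summit.RiemannHypothesis.RiemannHypothesis.Theorems.EvenWinsBeyondArch

open Literature.NumberTheory.LFunctions
open Literature.Analysis.ValidatedNumerics Literature.Analysis.ValidatedNumerics.PolyMP
  Literature.Analysis.ValidatedNumerics.NumericsMP Literature.Analysis.ValidatedNumerics.ExpPoly

/-- The ONE cheap check behind the window constants of a `{2,3,4,5}`-window (four slots). -/
def dt_constCheckL4 (S K Ke ke : ℕ) (c : ℚ) (m : ℕ) : Bool :=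
  (dt_PsiFar S K Ke ke c).isSome && (MI.expPt S Ke ke (ofRat S (c / 2))).isSome &&
  (MI.expPt S Ke ke (ofRat S (-(c / 2)))).isSome && (dt_C0 S K).isSome &&
  (dt_IwSqrt S K Ke ke 2).isSome && (MI.logNat S K 2).isSome && (dt_IwSqrt S K Ke ke 3).isSome &&
  (MI.logNat S K 3).isSome && (dt_IwHalf S K).isSome && (MI.logNat S K 4).isSome &&
  (dt_IwSqrt S K Ke ke 5).isSome && (MI.logNat S K 5).isSome &&
  (match dt_logRat S K (c / m) with | some Y => decide (Y.hi ≤ 0) | none => false) &&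
  dt_fourWindowCheck S K c

section MkWin4

variable {S K Ke ke : ℕ} {c : ℚ} {m : ℕ}

/-- What `dt_constCheckL4` certifies about the shared constants. -/
theorem dt_constCheckL4_sound (hS : 0 < S) (hc : 0 < c) (hm : 0 < m)
    (hchk : dt_constCheckL4 S K Ke ke c m = true) :
    MI.mem S (weilArchTail (2 * (c : ℝ))) ((dt_PsiFar S K Ke ke c).getD default) ∧
    MI.mem S (Real.exp ((c : ℝ) / 2)) (expRatMI S Ke ke (c / 2)) ∧
    MI.mem S (Real.exp (-((c : ℝ) / 2))) (expRatMI S Ke ke (-(c / 2))) ∧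
    MI.mem S (Real.log 2 + Real.pi / 4) ((dt_C0 S K).getD default) ∧
    MI.mem S (Real.log 2 / Real.sqrt 2) ((dt_IwSqrt S K Ke ke 2).getD default) ∧
    MI.mem S (Real.log 2) ((MI.logNat S K 2).getD default) ∧
    MI.mem S (Real.log 3 / Real.sqrt 3) ((dt_IwSqrt S K Ke ke 3).getD default) ∧
    MI.mem S (Real.log 3) ((MI.logNat S K 3).getD default) ∧
    MI.mem S (Real.log 2 / 2) ((dt_IwHalf S K).getD default) ∧
    MI.mem S (Real.log 4) ((MI.logNat S K 4).getD default) ∧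
    MI.mem S (Real.log 5 / Real.sqrt 5) ((dt_IwSqrt S K Ke ke 5).getD default) ∧
    MI.mem S (Real.log 5) ((MI.logNat S K 5).getD default) ∧
    ((((((dt_logRat S K (c / m)).getD default).lo : ℚ) / S : ℚ) : ℝ) ≤ Real.log (2 * ((c / (2 * m) : ℚ) : ℝ)) ∧
      Real.log (2 * ((c / (2 * m) : ℚ) : ℝ)) ≤ (((((dt_logRat S K (c / m)).getD default).hi : ℚ) / S : ℚ) : ℝ) ∧
      ((((dt_logRat S K (c / m)).getD default).hi : ℚ) / S : ℚ) ≤ 0) ∧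
    (Real.log 5 / 2 < (c : ℝ) ∧ (c : ℝ) ≤ Real.log 7 / 2) := by
  unfold dt_constCheckL4 at hchk
  simp only [Bool.and_eq_true] at hchk
  obtain ⟨⟨⟨⟨⟨⟨⟨⟨⟨⟨⟨⟨⟨hPsi, hEp⟩, hEm⟩, hC0⟩, hw1⟩, hL1⟩, hw2⟩, hL2⟩, hw3⟩, hL4⟩, hw5⟩, hL5⟩, hlog⟩, hwin⟩ := hchk
  cases hY : dt_logRat S K (c / m) with
  | none => simp [hY] at hlog
  | some Y =>
    simp only [hY, decide_eq_true_eq] at hlog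
    obtain ⟨hlo, hhi⟩ := dt_log_twoH_bounds hS hm hY (c := c)
    refine ⟨dt_mem_PsiFar hS hc (dt_eq_some_getD default hPsi), dt_mem_expHalf hS hEp, dt_mem_expNegHalf hS hEm,
      dt_mem_C0 hS (dt_eq_some_getD default hC0), dt_mem_IwSqrt hS two_pos (dt_eq_some_getD default hw1),
      ?_, dt_mem_IwSqrt hS three_pos (dt_eq_some_getD default hw2), ?_, dt_mem_IwHalf hS (dt_eq_some_getD default hw3),
      ?_, dt_mem_IwSqrt hS (by norm_num : 0 < 5) (dt_eq_some_getD default hw5), ?_, ⟨?_, ?_, ?_⟩, ?_⟩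
    · have := dt_mem_logNat hS (dt_eq_some_getD default hL1); push_cast at this; exact this
    · have := dt_mem_logNat hS (dt_eq_some_getD default hL2); push_cast at this; exact this
    · have := dt_mem_logNat hS (dt_eq_some_getD default hL4); push_cast at this; exact this
    · have := dt_mem_logNat hS (dt_eq_some_getD default hL5); push_cast at this; exact this
    · simpa using hlo
    · simpa using hhi
    · simp only [Option.getD_some]
      have hS' : (0 : ℚ) < S := by exact_mod_cast hS
      exact div_nonpos_of_nonpos_of_nonneg (by exact_mod_cast hlog) hS'.le
    · exact dt_fourWindow_sound hS hwin

/-- **The four-slot window bundle from checks and entry facts** (`(log 5)/2 < c ≤ (log 7)/2`). -/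
def dt_mkWinL4 (hS : 0 < S) (hc : 0 < c) (hm : 0 < m) {Dl : ℕ} (hchk : dt_constCheckL4 S K Ke ke c m = true)
    {Dρ : List (IPoly × Poly)} (hDρl : Dρ.length = 2 * m)
    (hDρ : ∀ i : Fin Dρ.length, 1 ≤ (i : ℕ) →
      TMem S (c / (2 * m)) (fun u ↦ weilArchDensity ((PolyMP.panelCentre (c / (2 * m)) i : ℝ) + u)) (Dρ.get i).1)
    {mu : List (List MI)}
    (hmu : ∀ i, 1 ≤ i → i < 2 * m → ∀ b, b < Dl + 1 →
      MI.mem S (∫ u in (-((c / (2 * m) : ℚ) : ℝ))..((c / (2 * m) : ℚ) : ℝ),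
        weilArchDensity (((PolyMP.panelCentre (c / (2 * m)) i : ℚ) : ℝ) + u) * u ^ b) ((mu.getD i []).getD b default))
    {M0 : List MI}
    (hM0 : ∀ j, j < M0.length →
      MI.mem S (∫ t in (0 : ℝ)..(2 * ((c / (2 * m) : ℚ) : ℝ)), weilArchDensityG t * t ^ j) (M0.getD j default))
    {DG0 : IPoly × Poly}
    (hDG0 : TMem S (c / (2 * m)) (fun u ↦ weilArchDensityG (((PolyMP.panelCentre (c / (2 * m)) 0 : ℚ) : ℝ) + u)) DG0.1)
    (Qinv : Poly) (eK : ℕ) (pK : Poly) : dt_WinL4 S c m Dl where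
  w1 := Real.log 2 / Real.sqrt 2
  L1 := Real.log 2
  w2 := Real.log 3 / Real.sqrt 3
  L2 := Real.log 3
  w3 := Real.log 2 / 2
  L3 := Real.log 4
  w4 := Real.log 5 / Real.sqrt 5
  L4 := Real.log 5
  Dρ := Dρ
  mu := mu
  M0 := M0
  DG0 := DG0
  Qinv := Qinv
  eK := eK
  pK := pK
  PsiFar := (dt_PsiFar S K Ke ke c).getD default
  C0 := (dt_C0 S K).getD default
  Iw1 := (dt_IwSqrt S K Ke ke 2).getD default
  IL1 := (MI.logNat S K 2).getD default
  Iw2 := (dt_IwSqrt S K Ke ke 3).getD default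
  IL2 := (MI.logNat S K 3).getD default
  Iw3 := (dt_IwHalf S K).getD default
  IL3 := (MI.logNat S K 4).getD default
  Iw4 := (dt_IwSqrt S K Ke ke 5).getD default
  IL4 := (MI.logNat S K 5).getD default
  llo := ((((dt_logRat S K (c / m)).getD default).lo : ℚ) / S : ℚ)
  lhi := ((((dt_logRat S K (c / m)).getD default).hi : ℚ) / S : ℚ)
  hDρl := hDρl
  hDρ := hDρ
  hmu := hmu
  hM0 := hM0
  hDG0 := hDG0
  hFar := (dt_constCheckL4_sound hS hc hm hchk).1
  hC0 := (dt_constCheckL4_sound hS hc hm hchk).2.2.2.1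
  hw1 := (dt_constCheckL4_sound hS hc hm hchk).2.2.2.2.1
  hL1 := (dt_constCheckL4_sound hS hc hm hchk).2.2.2.2.2.1
  hw2 := (dt_constCheckL4_sound hS hc hm hchk).2.2.2.2.2.2.1
  hL2 := (dt_constCheckL4_sound hS hc hm hchk).2.2.2.2.2.2.2.1
  hw3 := (dt_constCheckL4_sound hS hc hm hchk).2.2.2.2.2.2.2.2.1
  hL3 := (dt_constCheckL4_sound hS hc hm hchk).2.2.2.2.2.2.2.2.2.1
  hw4 := (dt_constCheckL4_sound hS hc hm hchk).2.2.2.2.2.2.2.2.2.2.1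
  hL4 := (dt_constCheckL4_sound hS hc hm hchk).2.2.2.2.2.2.2.2.2.2.2.1
  hllo := (dt_constCheckL4_sound hS hc hm hchk).2.2.2.2.2.2.2.2.2.2.2.2.1.1
  hlhi := (dt_constCheckL4_sound hS hc hm hchk).2.2.2.2.2.2.2.2.2.2.2.2.1.2.1
  hlhi0 := (dt_constCheckL4_sound hS hc hm hchk).2.2.2.2.2.2.2.2.2.2.2.2.1.2.2

/-- The window range of a four-slot window, from the same check (the hypotheses of `dt_hprimes_four`). -/
theorem dt_mkWinL4_window (hS : 0 < S) (hc : 0 < c) (hm : 0 < m) (hchk : dt_constCheckL4 S K Ke ke c m = true) :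
    Real.log 5 / 2 < (c : ℝ) ∧ (c : ℝ) ≤ Real.log 7 / 2 :=
  (dt_constCheckL4_sound hS hc hm hchk).2.2.2.2.2.2.2.2.2.2.2.2.2

end MkWin4

section Assembly4

variable {c : ℚ} {k : ℕ} {gp : Fin k → Poly} {v F : Fin k → ℝ → ℂ}

/-- **`hs` of the sigma criterion from the per-panel bounds (four slots).**  As `dt_hs_of_panelQL` with the four-slot form
of the prime sum (`dt_hprimes_four`, `(log 5)/2 < c ≤ (log 7)/2`) and the residual `dt_windowResidual4`: with
`W_il = W̃_il + [l = i](M̃ − M_c)`, `∫ ‖F_i − Σ_l W_il v_l‖² ≤ 2 Σ_{j<m} q_j`. [cite: GoerischHaunhorst1985, §2]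
[cite: Bombieri2000Weil, Thm 2] -/
theorem dt_hs_of_panelQL4 (hc : 0 < c) {σ : ℝ} (hσ : σ = 1 ∨ σ = -1)
    (hgp : ∀ i x, Poly.eval (gp i) (-x) = σ * Poly.eval (gp i) x)
    (hv : ∀ i x, v i x = (((Icc (-(c : ℝ)) c).indicator (fun x ↦ Poly.eval (gp i) x) x : ℝ) : ℂ))
    (hF : ∀ i y, F i y = (Icc (-(c : ℝ)) c).indicator (fun y ↦
        2 * (∫ x, v i x * (Real.cosh (x / 2) : ℂ)) * (Real.cosh (y / 2) : ℂ) -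
          2 * (∫ x, v i x * (Real.sinh (x / 2) : ℂ)) * (Real.sinh (y / 2) : ℂ) +
        (∑ n ∈ weilPrimeIndex (c : ℝ), (((ArithmeticFunction.vonMangoldt n : ℝ) / Real.sqrt n : ℝ) : ℂ) *
          (2 * v i y - v i (y - Real.log n) - v i (y + Real.log n))) +
        ∫ t in Ioi 0, (weilArchDensity t : ℂ) * (2 * v i y - v i (y - t) - v i (y + t))) y -
      (weilMarkovConstant (c : ℝ) : ℂ) * v i y)
    {w1 L1 w2 L2 w3 L3 w4 L4 : ℝ} (Mt : ℚ) (Wt : Fin k → Fin k → ℚ) (i : Fin k)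
    (hprimes : ∀ y : ℝ, ∑ n ∈ weilPrimeIndex (c : ℝ), ((ArithmeticFunction.vonMangoldt n : ℝ) / Real.sqrt n) *
        (2 * Poly.eval (gp i) y - (Icc (-(c : ℝ)) c).indicator (fun x ↦ Poly.eval (gp i) x) (y - Real.log n) -
          (Icc (-(c : ℝ)) c).indicator (fun x ↦ Poly.eval (gp i) x) (y + Real.log n)) =
      w1 * (2 * Poly.eval (gp i) y - (Icc (-(c : ℝ)) c).indicator (fun x ↦ Poly.eval (gp i) x) (y - L1) -
          (Icc (-(c : ℝ)) c).indicator (fun x ↦ Poly.eval (gp i) x) (y + L1)) +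
        w2 * (2 * Poly.eval (gp i) y - (Icc (-(c : ℝ)) c).indicator (fun x ↦ Poly.eval (gp i) x) (y - L2) -
          (Icc (-(c : ℝ)) c).indicator (fun x ↦ Poly.eval (gp i) x) (y + L2)) +
        w3 * (2 * Poly.eval (gp i) y - (Icc (-(c : ℝ)) c).indicator (fun x ↦ Poly.eval (gp i) x) (y - L3) -
          (Icc (-(c : ℝ)) c).indicator (fun x ↦ Poly.eval (gp i) x) (y + L3)) +
        w4 * (2 * Poly.eval (gp i) y - (Icc (-(c : ℝ)) c).indicator (fun x ↦ Poly.eval (gp i) x) (y - L4) -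
          (Icc (-(c : ℝ)) c).indicator (fun x ↦ Poly.eval (gp i) x) (y + L4)))
    {m : ℕ} (hm : 0 < m) (q : ℕ → ℚ)
    (hq : ∀ j, j < m →
      IntervalIntegrable (fun ρ ↦ dt_windowResidual4 (c : ℝ) gp w1 L1 w2 L2 w3 L3 w4 L4 (Mt : ℝ) (fun a l ↦ (Wt a l : ℝ)) i
        (((PolyMP.panelCentre (c / (2 * m)) j : ℚ) : ℝ) + ρ) ^ 2) volume (-((c / (2 * m) : ℚ) : ℝ)) ((c / (2 * m) : ℚ) : ℝ) →
      ∫ ρ in (-((c / (2 * m) : ℚ) : ℝ))..((c / (2 * m) : ℚ) : ℝ),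
          dt_windowResidual4 (c : ℝ) gp w1 L1 w2 L2 w3 L3 w4 L4 (Mt : ℝ) (fun a l ↦ (Wt a l : ℝ)) i
            (((PolyMP.panelCentre (c / (2 * m)) j : ℚ) : ℝ) + ρ) ^ 2 ≤ ((q j : ℚ) : ℝ)) :
    ∫ y, ‖(F i - ∑ l, ((Wt i l : ℝ) + if l = i then (Mt : ℝ) - weilMarkovConstant (c : ℝ) else 0) • v l) y‖ ^ 2 ≤
      2 * ∑ j ∈ Finset.range m, ((q j : ℚ) : ℝ) := by
  have hc' : (0 : ℝ) < c := by exact_mod_cast hc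
  refine dt_residual_normSq_le_of_panelBounds4 hc' hσ hgp hv hF (Mt : ℝ) (fun a l ↦ (Wt a l : ℝ)) i hprimes hm
    (fun j ↦ ((q j : ℚ) : ℝ)) fun j hj ↦ ?_
  have e1 : (2 * (j : ℝ) + 1) * ((c : ℝ) / (2 * m)) = ((PolyMP.panelCentre (c / (2 * m)) j : ℚ) : ℝ) :=
    (dt_panelCentre_castL c m j).symm
  have e2 : (c : ℝ) / (2 * m) = ((c / (2 * m) : ℚ) : ℝ) := (dt_halfWidth_cast c m).symm
  have hRi := dt_windowResidual4_sq_intervalIntegrable hc' hv hF (Mt : ℝ) (fun a l ↦ (Wt a l : ℝ)) i hprimes hm hj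
  rw [e1, e2] at hRi ⊢
  exact hq j hj hRi

end Assembly4

end Summit.RiemannHypothesis.RiemannHypothesis.Theorems.EvenWinsBeyondArch

end
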